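import Literature.NumberTheory.Automorphic.SplitOrthogonalSatakeIsomorphism
import Literature.NumberTheory.Automorphic.HyperspecialUnitarySphericalCharactersUnique
import Literature.NumberTheory.Automorphic.HeckeEigencharacterWeylInvarianceUnitary
import HarnessLib

/-!
# Cartier's Corollary 4.2 for every hyperspecial `U(σ, J₀)` and every Weyl-invariant normalisation: the characters of
# `ℋ(G, K₀; ℂ)` are the `λ_χ`, `χ` an unramified character of the torus, unique up to `W` — in particular for the split
# orthogonal group `O_N(J₀)` (Cartier 1979 §IV Cor. 4.2; Satake 1963 §6, §§8–9)

Topic `NumberTheory/Automorphic`; namespace `Literature.NumberTheory.Automorphic.HermitianLattice.UnramifiedLocalConjDatum`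
(lane `lit-hodgefound`, Track 2 foundations; seat `lit-hodgefound-p11`, generation 49, row g49-#4).  THEOREMS ONLY: no definition,
no named fact, no instance, no notation.  Generalises `HyperspecialUnitarySphericalCharacters[Unique]` (g48-#9/#10: `σ ≠ id`, the
`ℂ`-valued transform `hd.satakeTransform`) to an arbitrary datum `σ` and an arbitrary weight `w` whose transforms are
`W`-invariant, through the surjectivity criterion `satakeAlgEquivOfForallMem` of `SplitOrthogonalSatakeIsomorphism` (g49-#3).

## The mathematics

`G = U(σ, J₀^{(N)})` over a `ℤᵐ⁰`-valued field with datum `hd` (any `σ`) and finite residue field, `K₀` hyperspecial,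
`𝒮_w : ℋ(G, K₀; ℂ) → ℂ[ℤ^N]` the Satake transform with a weight `w : ℤ^N → ℂˣ` such that every `𝒮_w(T)` lies in
`ℂ[Λ⁻]^W = unitarySatakeTarget ℂ N` (`W = C_{S_N}(rev)`; e.g. `σ ≠ id` with `w = q_F^{-⟨ν,·⟩}`, or `σ = id` — the split orthogonal
group `O_N(J₀)` — with `w = u^{-Λ}`, `u² = q`, `SplitOrthogonalSatakeWeylInvariance`).  For a character `χ : ℤ^N → ℂˣ` of the
diagonal torus let `λ_χ = ev_χ ∘ 𝒮_w : ℋ(G, K₀; ℂ) → ℂ` (`IsIwasawaExponent.heckeEigencharacter w χ`).  THEOREM (Cartier Cor. 4.2):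

* (existence) **every `ℂ`-algebra homomorphism `ψ : ℋ(G, K₀; ℂ) → ℂ` is `λ_χ` for some `χ`**;
* (uniqueness) **`λ_{χ'} = λ_χ` iff `χ'|_{Λ⁻}` and `χ|_{Λ⁻}` are `W`-conjugate**: `∃ π ∈ C_{S_N}(rev)`, `χ'(μ) = χ(μ ∘ π)` for all
  `μ ∈ Λ⁻`.

So `Hom_{ℂ-alg}(ℋ(G, K₀; ℂ), ℂ) ≅ Hom(Λ⁻, ℂˣ)/W`; for `O_N(J₀)` (`σ = id`): the unramified characters of `ℋ(O_N(J₀), K₀)` are the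
`W(B_m)`-orbits (signed permutations) of unramified characters of the split torus.  PROOF as in g48-#9/#10 (`𝒮_w` is an isomorphism
onto `ℂ[Λ⁻]^W = (ℂ[Λ⁻])^W`; characters of the invariant subalgebra extend to `ℂ[Λ⁻]` — `ℂ[Λ⁻]` is integral over it and `ℂ` is
algebraically closed (`FixedPointSubalgebraCharacters`); characters of `ℂ[Λ⁻]` are restrictions of torus characters (Siegel retraction);
`W` is transitive on the characters of `ℂ[Λ⁻]` over a given character of the invariants, [BourbakiAC5to7] V §2 no. 2 Thm. 2).

## What is formalised (theorems only; `hmem : ∀ T, 𝒮_w(T) ∈ ℂ[Λ⁻]^W`)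

* §1 `exists_satakeTransform_eq_embLaurent_of_forall_mem`, `heckeEigencharacter_laurentMonomialHom_eq_evalChar`.
* §2 **`exists_eq_heckeEigencharacter_of_forall_mem`** (EXISTENCE, with `χ : Multiplicative (Fin N → ℤ) →* ℂ`),
  `exists_eq_heckeEigencharacter_laurentMonomialHom_of_forall_mem` (with `β ∈ (ℂˣ)^N`).
* §3 `heckeEigencharacter_eq_of_exists_perm_of_forall_mem` (⇐), **`exists_perm_of_heckeEigencharacter_eq_of_forall_mem`** (⇒),
  **`heckeEigencharacter_eq_iff_exists_perm_of_forall_mem`** (UNIQUENESS UP TO `W`).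
* §4 (`σ = id`, `u² = q`, `w = u^{-Λ}`) **`exists_eq_heckeEigencharacter_orthogonal`**, **`heckeEigencharacter_eq_iff_exists_perm_orthogonal`**
  (CARTIER COR. 4.2 FOR THE SPLIT ORTHOGONAL GROUP `O_N(J₀)` IN EVERY RANK).
* §5 (any commutative `R`) `heckeEigencharacter_comp_perm_of_forall_mem` (`λ_{χ ∘ π_*} = λ_χ` whenever the transforms are
  `W`-invariant), `heckeEigencharacter_comp_perm_of_units_orthogonal` (`O_N(J₀)`, `u² = q`).

## References
* [CartierCorvallis1979] P. Cartier, *Representations of 𝔭-adic groups: a survey*, PSPM 33.1 (1979), §IV Thm. 4.1, Cor. 4.2.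
* [Satake1963] I. Satake, *Theory of spherical functions on reductive algebraic groups over 𝔭-adic fields*, Publ. Math. IHÉS 18
  (1963), §6, §§8–9.
* [BourbakiAC5to7] N. Bourbaki, *Algèbre commutative*, Ch. V §2 no. 2 Thm. 2; §1 no. 9 Prop. 22.
* [BorelCorvallis1979] A. Borel, *Automorphic L-functions*, PSPM 33.2 (1979), §6, §7 (unramified parameters).
-/

noncomputable section

open scoped Valued WithZero Matrix MatrixGroups Pointwise
open MonoidAlgebra Representation

namespace Literature.NumberTheory.Automorphic.HermitianLattice

open Literature.NumberTheory.Automorphic Literature.NumberTheory.Automorphic.CartanUnique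

variable {N : ℕ} {K : Type*} [Field K] [Valued K ℤᵐ⁰] {σ : K →+* K} {ϖ : K}

namespace UnramifiedLocalConjDatum

section General

variable [IsHeckeTriple (⊤ : Submonoid (unitaryGroupOfForm σ ((StdForm.antidiagonal N).over K)))
    (unitaryInt σ ((StdForm.antidiagonal N).over K)) (unitaryInt σ ((StdForm.antidiagonal N).over K))]

/-! ## §1 Transforms as elements of `ℂ[Λ⁻]`, eigencharacters as evaluations -/

/-- **Every `W`-fixed `b ∈ ℂ[Λ⁻]` is `ι_*⁻¹ 𝒮_w(T)` for some `T`** (surjectivity criterion). [cite: CartierCorvallis1979, §IV Thm. 4.1] -/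
theorem exists_satakeTransform_eq_embLaurent_of_forall_mem (hd : UnramifiedLocalConjDatum σ ϖ)
    (w : Multiplicative (Fin N → ℤ) →* ℂ)
    (hmem : ∀ T : heckeAlgebra ℂ (unitaryGroupOfForm σ ((StdForm.antidiagonal N).over K)) (unitaryInt σ ((StdForm.antidiagonal N).over K)),
      (hd.isIwasawaExponent (N := N)).satakeTransform w T ∈ unitarySatakeTarget ℂ N)
    {b : AddMonoidAlgebra ℂ (antisymmLattice N)} (hb : ∀ π : revCentralizer N, (letI := weylAction N; π • b) = b) :
    ∃ T : heckeAlgebra ℂ (unitaryGroupOfForm σ ((StdForm.antidiagonal N).over K)) (unitaryInt σ ((StdForm.antidiagonal N).over K)),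
      (hd.isIwasawaExponent (N := N)).satakeTransform w T = embLaurent N b :=
  hd.exists_isIwasawaExponent_satakeTransform_eq_of_forall_mem w hmem _ ((forall_smul_eq_self_iff_mem_unitarySatakeTarget b).1 hb)

omit [IsHeckeTriple (⊤ : Submonoid (unitaryGroupOfForm σ ((StdForm.antidiagonal N).over K)))
    (unitaryInt σ ((StdForm.antidiagonal N).over K)) (unitaryInt σ ((StdForm.antidiagonal N).over K))] in
/-- `λ_{χ_β}(T) = ev_{χ_β}(b)` when `𝒮_w(T) = ι_* b` (`χ_β = (β^·)`). [cite: CartierCorvallis1979, §IV Cor. 4.2] -/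
theorem heckeEigencharacter_laurentMonomialHom_eq_evalChar (hd : UnramifiedLocalConjDatum σ ϖ)
    (w : Multiplicative (Fin N → ℤ) →* ℂ) (β : Fin N → ℂˣ)
    {T : heckeAlgebra ℂ (unitaryGroupOfForm σ ((StdForm.antidiagonal N).over K)) (unitaryInt σ ((StdForm.antidiagonal N).over K))}
    {b : AddMonoidAlgebra ℂ (antisymmLattice N)} (h : (hd.isIwasawaExponent (N := N)).satakeTransform w T = embLaurent N b) :
    (hd.isIwasawaExponent (N := N)).heckeEigencharacter w (laurentMonomialHom β) T = antisymmEvalChar β b := by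
  rw [IsIwasawaExponent.heckeEigencharacter_apply, h, ← laurentEvalAt_embLaurent]
  rfl

/-! ## §2 Existence: every character of `ℋ(G, K₀; ℂ)` is a `λ_χ` -/

/-- **CARTIER COR. 4.2 (EXISTENCE) FOR EVERY HYPERSPECIAL `U(σ, J₀^{(N)})` AND EVERY WEYL-INVARIANT WEIGHT**: if all transforms
`𝒮_w(T)` lie in `ℂ[Λ⁻]^W`, then every `ℂ`-algebra homomorphism `ψ : ℋ(U(σ, J₀^{(N)}), K₀; ℂ) → ℂ` is `λ_χ = ev_χ ∘ 𝒮_w` for some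
character `χ` of `ℤ^N`. [cite: CartierCorvallis1979, §IV Cor. 4.2] [cite: Satake1963, §6] [cite: BourbakiAC5to7, Ch. V §1 no. 9 Prop. 22] -/
theorem exists_eq_heckeEigencharacter_of_forall_mem (hd : UnramifiedLocalConjDatum σ ϖ) (w : Multiplicative (Fin N → ℤ) →* ℂ)
    (hmem : ∀ T : heckeAlgebra ℂ (unitaryGroupOfForm σ ((StdForm.antidiagonal N).over K)) (unitaryInt σ ((StdForm.antidiagonal N).over K)),
      (hd.isIwasawaExponent (N := N)).satakeTransform w T ∈ unitarySatakeTarget ℂ N)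
    (ψ : heckeAlgebra ℂ (unitaryGroupOfForm σ ((StdForm.antidiagonal N).over K)) (unitaryInt σ ((StdForm.antidiagonal N).over K))
      →ₐ[ℂ] ℂ) :
    ∃ χ : Multiplicative (Fin N → ℤ) →* ℂ, ψ = (hd.isIwasawaExponent (N := N)).heckeEigencharacter w χ := by
  classical
  letI := weylAction N
  -- the subalgebra `A = ι_*⁻¹(ℂ[Λ⁻]^W)` of `B = ℂ[Λ⁻]` contains the `W`-fixed points
  set A : Subalgebra ℂ (AddMonoidAlgebra ℂ (antisymmLattice N)) := (unitarySatakeTarget ℂ N).comap (embLaurent N) with hAdef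
  have hA : ∀ b : AddMonoidAlgebra ℂ (antisymmLattice N), (∀ g : revCentralizer N, g • b = b) → b ∈ A := fun b hb =>
    (Subalgebra.mem_comap _ _ _).2 ((forall_smul_eq_self_iff_mem_unitarySatakeTarget b).1 hb)
  -- the character `φ = ψ ∘ 𝒮_w⁻¹ ∘ ι_*` of `A`
  set toTarget : A →ₐ[ℂ] unitarySatakeTarget ℂ N :=
    ((embLaurent N).comp A.val).codRestrict (unitarySatakeTarget ℂ N) fun a => (Subalgebra.mem_comap _ _ _).1 a.2 with htoTarget
  set φ : A →ₐ[ℂ] ℂ := (ψ.comp (hd.satakeAlgEquivOfForallMem (N := N) w hmem).symm.toAlgHom).comp toTarget with hφ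
  -- extend `φ` to `Ψ : ℂ[Λ⁻] → ℂ`, a character `χ₀` of `Λ⁻`, extended to `χ` on `ℤ^N` along the Siegel retraction
  obtain ⟨Ψ, hΨ⟩ := exists_algHom_extend_of_fixedPoints A hA φ
  set χ₀ : Multiplicative (antisymmLattice N) →* ℂ := (AddMonoidAlgebra.lift ℂ ℂ (antisymmLattice N)).symm Ψ with hχ₀
  have hΨχ : Ψ = AddMonoidAlgebra.lift ℂ ℂ (antisymmLattice N) χ₀ := by rw [hχ₀, Equiv.apply_symm_apply]
  set χ : Multiplicative (Fin N → ℤ) →* ℂ := χ₀.comp (AddMonoidHom.toMultiplicative (siegelRetract N)) with hχ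
  have hχχ₀ : χ.comp (AddMonoidHom.toMultiplicative (antisymmLattice N).subtype) = χ₀ := by
    refine MonoidHom.ext fun m => ?_
    show χ₀ (Multiplicative.ofAdd (siegelRetract N ((antisymmLattice N).subtype (Multiplicative.toAdd m)))) = χ₀ m
    rw [AddSubgroup.coe_subtype, siegelRetract_coe]
    rfl
  refine ⟨χ, AlgHom.ext fun T => ?_⟩
  -- unwind: `ψ T = φ(b_T) = Ψ(b_T) = χ(𝒮_w T)`
  have hST := hmem T
  obtain ⟨bT, hbT⟩ := (AlgHom.mem_range _).1 (((mem_unitarySatakeTarget_iff _).1 hST).1 |> (mem_antisymmSupported_iff _).2)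
  have hbT' : embLaurent N bT = (hd.isIwasawaExponent (N := N)).satakeTransform w T := hbT
  have hbA : bT ∈ A := (Subalgebra.mem_comap _ _ _).2 (by rw [hbT']; exact hST)
  have h1 : ψ T = φ ⟨bT, hbA⟩ := by
    show ψ T = ψ ((hd.satakeAlgEquivOfForallMem (N := N) w hmem).symm (toTarget ⟨bT, hbA⟩))
    congr 1
    refine ((AlgEquiv.symm_apply_eq _).2 (Subtype.ext ?_)).symm
    rw [coe_satakeAlgEquivOfForallMem, htoTarget, AlgHom.coe_codRestrict, AlgHom.comp_apply, Subalgebra.coe_val]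
    exact hbT'
  rw [h1, ← hΨ ⟨bT, hbA⟩, IsIwasawaExponent.heckeEigencharacter_apply, ← hbT', embLaurent_apply, lift_mapDomain, hχχ₀, hΨχ]

/-- **Existence with a parameter `β ∈ (ℂˣ)^N`**: every character of `ℋ(U(σ, J₀^{(N)}), K₀; ℂ)` is `λ_{χ_β}`, `χ_β(μ) = β^μ`.
[cite: CartierCorvallis1979, §IV Cor. 4.2] [cite: BorelCorvallis1979, §7] -/
theorem exists_eq_heckeEigencharacter_laurentMonomialHom_of_forall_mem (hd : UnramifiedLocalConjDatum σ ϖ)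
    (w : Multiplicative (Fin N → ℤ) →* ℂ)
    (hmem : ∀ T : heckeAlgebra ℂ (unitaryGroupOfForm σ ((StdForm.antidiagonal N).over K)) (unitaryInt σ ((StdForm.antidiagonal N).over K)),
      (hd.isIwasawaExponent (N := N)).satakeTransform w T ∈ unitarySatakeTarget ℂ N)
    (ψ : heckeAlgebra ℂ (unitaryGroupOfForm σ ((StdForm.antidiagonal N).over K)) (unitaryInt σ ((StdForm.antidiagonal N).over K))
      →ₐ[ℂ] ℂ) :
    ∃ β : Fin N → ℂˣ, ψ = (hd.isIwasawaExponent (N := N)).heckeEigencharacter w (laurentMonomialHom β) := by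
  obtain ⟨χ, hχ⟩ := hd.exists_eq_heckeEigencharacter_of_forall_mem w hmem ψ
  obtain ⟨β, hβ⟩ := exists_laurentMonomialHom_eq χ
  exact ⟨β, by rw [hβ]; exact hχ⟩

/-! ## §3 Uniqueness up to `W` -/

omit [IsHeckeTriple (⊤ : Submonoid (unitaryGroupOfForm σ ((StdForm.antidiagonal N).over K)))
    (unitaryInt σ ((StdForm.antidiagonal N).over K)) (unitaryInt σ ((StdForm.antidiagonal N).over K))] in
/-- **(⇐) `W`-conjugate torus characters give the same eigencharacter**: if `χ'(μ) = χ(μ ∘ π)` on `Λ⁻` for some `π ∈ W`, then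
`λ_{χ'} = λ_χ` (the coefficients of `𝒮_w(T)` are `W`-invariant and supported on `Λ⁻`). [cite: CartierCorvallis1979, §IV Cor. 4.2] -/
theorem heckeEigencharacter_eq_of_exists_perm_of_forall_mem (hd : UnramifiedLocalConjDatum σ ϖ)
    (w : Multiplicative (Fin N → ℤ) →* ℂ)
    (hmem : ∀ T : heckeAlgebra ℂ (unitaryGroupOfForm σ ((StdForm.antidiagonal N).over K)) (unitaryInt σ ((StdForm.antidiagonal N).over K)),
      (hd.isIwasawaExponent (N := N)).satakeTransform w T ∈ unitarySatakeTarget ℂ N)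
    {χ χ' : Multiplicative (Fin N → ℤ) →* ℂ} {π : Equiv.Perm (Fin N)} (hπ : ∀ i, π (Fin.rev i) = Fin.rev (π i))
    (h : ∀ μ : Fin N → ℤ, (∀ i, μ (Fin.rev i) = -μ i) → χ' (Multiplicative.ofAdd μ) = χ (Multiplicative.ofAdd (μ ∘ ⇑π))) :
    (hd.isIwasawaExponent (N := N)).heckeEigencharacter w χ' = (hd.isIwasawaExponent (N := N)).heckeEigencharacter w χ := by
  letI := weylAction N
  obtain ⟨β, rfl⟩ := exists_laurentMonomialHom_eq χ
  obtain ⟨β', rfl⟩ := exists_laurentMonomialHom_eq χ'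
  refine AlgHom.ext fun T => ?_
  have hST := hmem T
  obtain ⟨b, hb⟩ := (AlgHom.mem_range _).1 (((mem_unitarySatakeTarget_iff _).1 hST).1 |> (mem_antisymmSupported_iff _).2)
  have hb' : (hd.isIwasawaExponent (N := N)).satakeTransform w T = embLaurent N b := hb.symm
  have hfix : ∀ ρ : revCentralizer N, ρ • b = b :=
    (forall_smul_eq_self_iff_mem_unitarySatakeTarget b).2 (by rw [← hb']; exact hST)
  rw [hd.heckeEigencharacter_laurentMonomialHom_eq_evalChar w β' hb', hd.heckeEigencharacter_laurentMonomialHom_eq_evalChar w β hb']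
  -- `χ_{β'} = χ_β ∘ e` with `e = (μ ↦ μ ∘ π)` on `Λ⁻`, and `b` is `e`-invariant
  set g : revCentralizer N := ⟨π, hπ⟩ with hg
  have hchar : (laurentMonomialHom β').comp (AddMonoidHom.toMultiplicative (antisymmLattice N).subtype) =
      ((laurentMonomialHom β).comp (AddMonoidHom.toMultiplicative (antisymmLattice N).subtype)).comp
        (AddMonoidHom.toMultiplicative (antisymmLatticeCongr g⁻¹).toAddMonoidHom) := by
    refine MonoidHom.ext fun m => ?_
    show laurentMonomialHom β' (Multiplicative.ofAdd ((Multiplicative.toAdd m : antisymmLattice N) : Fin N → ℤ)) =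
      laurentMonomialHom β (Multiplicative.ofAdd ((antisymmLatticeCongr g⁻¹ (Multiplicative.toAdd m) : antisymmLattice N) : Fin N → ℤ))
    rw [h _ (Multiplicative.toAdd m).2, coe_antisymmLatticeCongr, Subgroup.coe_inv, inv_inv]
  rw [antisymmEvalChar, antisymmEvalChar, hchar, lift_comp_toMultiplicative_eq_lift_domCongr]
  exact congrArg _ (hfix g⁻¹)

/-- **(⇒) Equal eigencharacters have `W`-conjugate torus characters**: if `λ_{χ'} = λ_χ` then `χ'(μ) = χ(μ ∘ π)` on `Λ⁻` for some
`π ∈ W` (transitivity of `W` on the characters of `ℂ[Λ⁻]` above a character of `ℂ[Λ⁻]^W`). [cite: CartierCorvallis1979, §IV Cor. 4.2]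
[cite: BourbakiAC5to7, Ch. V §2 no. 2 Thm. 2] -/
theorem exists_perm_of_heckeEigencharacter_eq_of_forall_mem (hd : UnramifiedLocalConjDatum σ ϖ)
    (w : Multiplicative (Fin N → ℤ) →* ℂ)
    (hmem : ∀ T : heckeAlgebra ℂ (unitaryGroupOfForm σ ((StdForm.antidiagonal N).over K)) (unitaryInt σ ((StdForm.antidiagonal N).over K)),
      (hd.isIwasawaExponent (N := N)).satakeTransform w T ∈ unitarySatakeTarget ℂ N)
    {χ χ' : Multiplicative (Fin N → ℤ) →* ℂ}
    (h : (hd.isIwasawaExponent (N := N)).heckeEigencharacter w χ' = (hd.isIwasawaExponent (N := N)).heckeEigencharacter w χ) :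
    ∃ π : Equiv.Perm (Fin N), (∀ i, π (Fin.rev i) = Fin.rev (π i)) ∧
      ∀ μ : Fin N → ℤ, (∀ i, μ (Fin.rev i) = -μ i) → χ' (Multiplicative.ofAdd μ) = χ (Multiplicative.ofAdd (μ ∘ ⇑π)) := by
  classical
  letI := weylAction N
  obtain ⟨β, rfl⟩ := exists_laurentMonomialHom_eq χ
  obtain ⟨β', rfl⟩ := exists_laurentMonomialHom_eq χ'
  -- `A = ℂ[Λ⁻]^W ⊆ B = ℂ[Λ⁻]`
  set A : Subalgebra ℂ (AddMonoidAlgebra ℂ (antisymmLattice N)) := (unitarySatakeTarget ℂ N).comap (embLaurent N) with hAdef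
  have hAfix : ∀ b : AddMonoidAlgebra ℂ (antisymmLattice N), b ∈ A ↔ ∀ g : revCentralizer N, g • b = b := fun b =>
    (Subalgebra.mem_comap _ _ _).trans (forall_smul_eq_self_iff_mem_unitarySatakeTarget b).symm
  haveI : Algebra.IsInvariant A (AddMonoidAlgebra ℂ (antisymmLattice N)) (revCentralizer N) :=
    ⟨fun b hb => ⟨⟨b, (hAfix b).2 hb⟩, rfl⟩⟩
  haveI : SMulCommClass (revCentralizer N) A (AddMonoidAlgebra ℂ (antisymmLattice N)) :=
    ⟨fun g a b => by
      rw [Algebra.smul_def, Algebra.smul_def, smul_mul']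
      show g • (a : AddMonoidAlgebra ℂ (antisymmLattice N)) * g • b = (a : AddMonoidAlgebra ℂ (antisymmLattice N)) * g • b
      rw [(hAfix a.1).1 a.2 g]⟩
  -- the two characters agree on `A`, so their kernels lie over the same maximal ideal of `A`
  have hagree : ∀ a : A, antisymmEvalChar β' (a : AddMonoidAlgebra ℂ (antisymmLattice N)) = antisymmEvalChar β a := fun a => by
    obtain ⟨T, hT⟩ := hd.exists_satakeTransform_eq_embLaurent_of_forall_mem w hmem ((hAfix a.1).1 a.2)
    rw [← hd.heckeEigencharacter_laurentMonomialHom_eq_evalChar w β' hT, ← hd.heckeEigencharacter_laurentMonomialHom_eq_evalChar w β hT, h]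
  have hsurj : ∀ γ : Fin N → ℂˣ, Function.Surjective (antisymmEvalChar (N := N) γ) := fun γ c =>
    ⟨algebraMap ℂ _ c, AlgHom.commutes _ c⟩
  haveI hM : (RingHom.ker (antisymmEvalChar β)).IsMaximal := RingHom.ker_isMaximal_of_surjective _ (hsurj β)
  haveI hM' : (RingHom.ker (antisymmEvalChar β')).IsMaximal := RingHom.ker_isMaximal_of_surjective _ (hsurj β')
  have hunder : (RingHom.ker (antisymmEvalChar β)).under A = (RingHom.ker (antisymmEvalChar β')).under A := by
    refine Ideal.ext fun a => ?_
    change a ∈ (RingHom.ker (antisymmEvalChar β)).comap (algebraMap A _) ↔ a ∈ (RingHom.ker (antisymmEvalChar β')).comap (algebraMap A _)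
    rw [Ideal.mem_comap, Ideal.mem_comap, RingHom.mem_ker, RingHom.mem_ker]
    show antisymmEvalChar β (a : AddMonoidAlgebra ℂ (antisymmLattice N)) = 0 ↔ antisymmEvalChar β' (a : AddMonoidAlgebra ℂ (antisymmLattice N)) = 0
    rw [hagree]
  obtain ⟨g, hg⟩ := Algebra.IsInvariant.exists_smul_of_under_eq (A := A) (B := AddMonoidAlgebra ℂ (antisymmLattice N))
    (G := revCentralizer N) (P := RingHom.ker (antisymmEvalChar β)) (Q := RingHom.ker (antisymmEvalChar β')) hunder
  -- `ev_{χ_{β'}} = ev_{χ_β} ∘ (g⁻¹ • ·)`: both are characters with the same kernel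
  set Φ : AddMonoidAlgebra ℂ (antisymmLattice N) →ₐ[ℂ] ℂ := (antisymmEvalChar β).comp (weylAlgAut N g⁻¹ : _ ≃ₐ[ℂ] _).toAlgHom with hΦ
  have hΦapply : ∀ b, Φ b = antisymmEvalChar β (g⁻¹ • b) := fun b => rfl
  have hker : RingHom.ker Φ ≤ RingHom.ker (antisymmEvalChar β') := fun b hb => by
    rw [RingHom.mem_ker] at hb ⊢
    have h1 : g⁻¹ • b ∈ RingHom.ker (antisymmEvalChar β) := by rw [RingHom.mem_ker]; exact hb
    have h2 : b ∈ g • RingHom.ker (antisymmEvalChar β) := Ideal.mem_pointwise_smul_iff_inv_smul_mem.2 h1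
    rw [← hg, RingHom.mem_ker] at h2
    exact h2
  have heq : antisymmEvalChar β' = Φ := algHom_eq_of_ker_le Φ (antisymmEvalChar β') hker
  refine ⟨(g : Equiv.Perm (Fin N)), g.2, fun μ hμ => ?_⟩
  have h1 : antisymmEvalChar β' (AddMonoidAlgebra.single ⟨μ, hμ⟩ 1) = Φ (AddMonoidAlgebra.single ⟨μ, hμ⟩ 1) := by rw [heq]
  rw [hΦapply, evalChar_inv_smul_single_one, evalChar_single_one] at h1
  exact h1

/-- **CARTIER COR. 4.2, UNIQUENESS UP TO `W`, FOR EVERY HYPERSPECIAL `U(σ, J₀^{(N)})` AND EVERY WEYL-INVARIANT WEIGHT**: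
`λ_{χ'} = λ_χ` iff `χ'|_{Λ⁻}` and `χ|_{Λ⁻}` are `W`-conjugate (`∃ π ∈ C_{S_N}(rev)`, `χ'(μ) = χ(μ ∘ π)` for all `μ ∈ Λ⁻`).  With §2:
`Hom_{ℂ-alg}(ℋ(U(σ, J₀^{(N)}), K₀; ℂ), ℂ) ≅ Hom(Λ⁻, ℂˣ)/W`. [cite: CartierCorvallis1979, §IV Cor. 4.2] [cite: Satake1963, §6]
[cite: BorelCorvallis1979, §7] -/
theorem heckeEigencharacter_eq_iff_exists_perm_of_forall_mem (hd : UnramifiedLocalConjDatum σ ϖ)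
    (w : Multiplicative (Fin N → ℤ) →* ℂ)
    (hmem : ∀ T : heckeAlgebra ℂ (unitaryGroupOfForm σ ((StdForm.antidiagonal N).over K)) (unitaryInt σ ((StdForm.antidiagonal N).over K)),
      (hd.isIwasawaExponent (N := N)).satakeTransform w T ∈ unitarySatakeTarget ℂ N)
    (χ χ' : Multiplicative (Fin N → ℤ) →* ℂ) :
    (hd.isIwasawaExponent (N := N)).heckeEigencharacter w χ' = (hd.isIwasawaExponent (N := N)).heckeEigencharacter w χ ↔
      ∃ π : Equiv.Perm (Fin N), (∀ i, π (Fin.rev i) = Fin.rev (π i)) ∧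
        ∀ μ : Fin N → ℤ, (∀ i, μ (Fin.rev i) = -μ i) → χ' (Multiplicative.ofAdd μ) = χ (Multiplicative.ofAdd (μ ∘ ⇑π)) :=
  ⟨hd.exists_perm_of_heckeEigencharacter_eq_of_forall_mem w hmem,
    fun ⟨_, hπ, h⟩ => hd.heckeEigencharacter_eq_of_exists_perm_of_forall_mem w hmem hπ h⟩

end General

/-! ## §4 The split orthogonal group `O_N(J₀)` -/

section Orthogonal

/-- **CARTIER COR. 4.2 (EXISTENCE) FOR THE SPLIT ORTHOGONAL GROUP `O_N(J₀)` IN EVERY RANK**: every `ℂ`-algebra homomorphism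
`ψ : ℋ(O_N(J₀), K₀; ℂ) → ℂ` is `λ_χ = ev_χ ∘ 𝒮_w` (orthogonal weight `w = u^{-Λ}`, `u² = q`) for some character `χ` of the diagonal
torus (`σ = id`, non-dyadic, finite residue field). [cite: Satake1963, §6, §§8–9] [cite: CartierCorvallis1979, §IV Cor. 4.2] -/
theorem exists_eq_heckeEigencharacter_orthogonal (hd : UnramifiedLocalConjDatum (RingHom.id K) ϖ) [Finite 𝓀[K]] (u : ℂˣ)
    (hu : (u : ℂ) ^ 2 = Nat.card 𝓀[K]) (w : Multiplicative (Fin N → ℤ) →* ℂ)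
    (hw : ∀ e : Fin N → ℤ, w (Multiplicative.ofAdd e) =
      ((u ^ (-∑ p ∈ (Finset.univ : Finset (Fin N × Fin N)) with (p.1 < p.2 ∧ p.1 < Fin.rev p.2), (e p.1 - e p.2)) : ℂˣ) : ℂ))
    [IsHeckeTriple (⊤ : Submonoid (unitaryGroupOfForm (RingHom.id K) ((StdForm.antidiagonal N).over K)))
      (unitaryInt (RingHom.id K) ((StdForm.antidiagonal N).over K)) (unitaryInt (RingHom.id K) ((StdForm.antidiagonal N).over K))]
    (ψ : heckeAlgebra ℂ (unitaryGroupOfForm (RingHom.id K) ((StdForm.antidiagonal N).over K))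
        (unitaryInt (RingHom.id K) ((StdForm.antidiagonal N).over K)) →ₐ[ℂ] ℂ) :
    ∃ χ : Multiplicative (Fin N → ℤ) →* ℂ, ψ = (hd.isIwasawaExponent (N := N)).heckeEigencharacter w χ :=
  hd.exists_eq_heckeEigencharacter_of_forall_mem w
    (fun T => hd.isIwasawaExponent_satakeTransform_mem_unitarySatakeTarget_orthogonal u hu w hw T) ψ

/-- **CARTIER COR. 4.2 (UNIQUENESS UP TO `W`) FOR `O_N(J₀)` IN EVERY RANK**: `λ_{χ'} = λ_χ` iff `χ'|_{Λ⁻}` and `χ|_{Λ⁻}` are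
conjugate under the signed permutation group `W = C_{S_N}(rev)`: the unramified characters of `ℋ(O_N(J₀), K₀; ℂ)` are the `W`-orbits
of unramified characters of the split torus. [cite: Satake1963, §6, §§8–9] [cite: CartierCorvallis1979, §IV Cor. 4.2] -/
theorem heckeEigencharacter_eq_iff_exists_perm_orthogonal (hd : UnramifiedLocalConjDatum (RingHom.id K) ϖ) [Finite 𝓀[K]]
    (u : ℂˣ) (hu : (u : ℂ) ^ 2 = Nat.card 𝓀[K]) (w : Multiplicative (Fin N → ℤ) →* ℂ)
    (hw : ∀ e : Fin N → ℤ, w (Multiplicative.ofAdd e) =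
      ((u ^ (-∑ p ∈ (Finset.univ : Finset (Fin N × Fin N)) with (p.1 < p.2 ∧ p.1 < Fin.rev p.2), (e p.1 - e p.2)) : ℂˣ) : ℂ))
    [IsHeckeTriple (⊤ : Submonoid (unitaryGroupOfForm (RingHom.id K) ((StdForm.antidiagonal N).over K)))
      (unitaryInt (RingHom.id K) ((StdForm.antidiagonal N).over K)) (unitaryInt (RingHom.id K) ((StdForm.antidiagonal N).over K))]
    (χ χ' : Multiplicative (Fin N → ℤ) →* ℂ) :
    (hd.isIwasawaExponent (N := N)).heckeEigencharacter w χ' = (hd.isIwasawaExponent (N := N)).heckeEigencharacter w χ ↔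
      ∃ π : Equiv.Perm (Fin N), (∀ i, π (Fin.rev i) = Fin.rev (π i)) ∧
        ∀ μ : Fin N → ℤ, (∀ i, μ (Fin.rev i) = -μ i) → χ' (Multiplicative.ofAdd μ) = χ (Multiplicative.ofAdd (μ ∘ ⇑π)) :=
  hd.heckeEigencharacter_eq_iff_exists_perm_of_forall_mem w
    (fun T => hd.isIwasawaExponent_satakeTransform_mem_unitarySatakeTarget_orthogonal u hu w hw T) χ χ'

end Orthogonal

/-! ## §5 Over any commutative ring: `λ_{χ ∘ π_*} = λ_χ` -/

section Integral

variable {R : Type*} [CommRing R]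

/-- **`λ_{χ ∘ π_*} = λ_χ` OVER ANY COMMUTATIVE RING** for every weight `w` whose transforms lie in `R[Λ⁻]^W` and every
`π ∈ C_{S_N}(rev)` (`π_* μ = μ ∘ π`): the integrally normalised eigencharacters `λ_χ = ev_χ ∘ 𝒮_w` of `ℋ(U(σ, J₀^{(N)}), K₀; R)` do
not change when the torus character `χ` is moved by the Weyl group. [cite: CartierCorvallis1979, §IV Thm. 4.1, Cor. 4.2] -/
theorem heckeEigencharacter_comp_perm_of_forall_mem (hd : UnramifiedLocalConjDatum σ ϖ)
    [IsHeckeTriple (⊤ : Submonoid (unitaryGroupOfForm σ ((StdForm.antidiagonal N).over K)))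
      (unitaryInt σ ((StdForm.antidiagonal N).over K)) (unitaryInt σ ((StdForm.antidiagonal N).over K))]
    (w : Multiplicative (Fin N → ℤ) →* R)
    (hmem : ∀ T : heckeAlgebra R (unitaryGroupOfForm σ ((StdForm.antidiagonal N).over K)) (unitaryInt σ ((StdForm.antidiagonal N).over K)),
      (hd.isIwasawaExponent (N := N)).satakeTransform w T ∈ unitarySatakeTarget R N)
    (χ : Multiplicative (Fin N → ℤ) →* R) {π : Equiv.Perm (Fin N)} (hπ : ∀ i, π (Fin.rev i) = Fin.rev (π i)) :
    (hd.isIwasawaExponent (N := N)).heckeEigencharacter w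
        (χ.comp (AddMonoidHom.toMultiplicative (LinearEquiv.funCongrLeft ℤ ℤ π).toAddEquiv.toAddMonoidHom)) =
      (hd.isIwasawaExponent (N := N)).heckeEigencharacter w χ := by
  refine (hd.isIwasawaExponent (N := N)).heckeEigencharacter_eq_of_forall_coeff w χ _ fun T μ => ?_
  rw [SymmLaurent.funCongrLeft_toAddEquiv_apply]
  exact ((mem_unitarySatakeTarget_iff _).1 (hmem T)).2 π hπ μ

/-- **`λ_{χ ∘ π_*} = λ_χ` for `O_N(J₀)` over any commutative `R`** (`u ∈ Rˣ`, `u² = q`, orthogonal weight `w = u^{-Λ}`; `π` a signed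
permutation, `π ∈ C_{S_N}(rev)`). [cite: Satake1963, §6, §§8–9] [cite: CartierCorvallis1979, §IV Cor. 4.2] -/
theorem heckeEigencharacter_comp_perm_of_units_orthogonal (hd : UnramifiedLocalConjDatum (RingHom.id K) ϖ) [Finite 𝓀[K]]
    (u : Rˣ) (hu : (u : R) ^ 2 = Nat.card 𝓀[K]) (w : Multiplicative (Fin N → ℤ) →* R)
    (hw : ∀ e : Fin N → ℤ, w (Multiplicative.ofAdd e) =
      ((u ^ (-∑ p ∈ (Finset.univ : Finset (Fin N × Fin N)) with (p.1 < p.2 ∧ p.1 < Fin.rev p.2), (e p.1 - e p.2)) : Rˣ) : R))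
    (χ : Multiplicative (Fin N → ℤ) →* R) {π : Equiv.Perm (Fin N)} (hπ : ∀ i, π (Fin.rev i) = Fin.rev (π i)) :
    (hd.isIwasawaExponent (N := N)).heckeEigencharacter w
        (χ.comp (AddMonoidHom.toMultiplicative (LinearEquiv.funCongrLeft ℤ ℤ π).toAddEquiv.toAddMonoidHom)) =
      (hd.isIwasawaExponent (N := N)).heckeEigencharacter w χ := by
  haveI := isHeckeTriple_unitaryInt_of_finite_residueField hd.vϖ (RingHom.id K) ((StdForm.antidiagonal N).over K)
  exact hd.heckeEigencharacter_comp_perm_of_forall_mem w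
    (fun T => hd.isIwasawaExponent_satakeTransform_mem_unitarySatakeTarget_orthogonal u hu w hw T) χ hπ

end Integral

end UnramifiedLocalConjDatum

end Literature.NumberTheory.Automorphic.HermitianLattice

end
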